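import Summits.BirchSwinnertonDyer.BirchSwinnertonDyer.Theorems.ManinLocalTwoThreeVeluTwoDiscriminant
import Summits.BirchSwinnertonDyer.BirchSwinnertonDyer.Theorems.ManinLocalTwoThreeTameTwoIVstarVeluB
import Summits.BirchSwinnertonDyer.BirchSwinnertonDyer.Theorems.ManinLocalTwoThreeHalfLatticeVeluAnyModel
import Literature.NumberTheory.EllipticCurves.ManinConstantGamma1Gamma0LedgerProofs
import Literature.NumberTheory.EllipticCurves.CuspFormLFunctionLevelConductorProofs
import Literature.NumberTheory.DiophantineGeometry.TameAdditiveTypesAtTwoProofs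
import HarnessLib

/-!
# No doubling on the tame `IV*` stratum: at `N = 4p` (`p` odd prime) an `X₀`-optimal curve of Kodaira type `IV*` at `2` has
# `|c₀| = |c₁|` — C2 for `D₀` is Stevens' parity `2 ∤ c₁` there (granted modularity, the crux's own hypothesis)

Summit `BirchSwinnertonDyer`, route `ManinLocalTwoThree` (cell bsd-f2-manin), DECIDING crux C2 `ManinOddAtFour`
(stmt-BirchSwinnertonDyer-22967); the `2`-adic twin of `…NoTriplingIIIstarNineP` (p642959).  The `2`-adic Γ₀/Γ₁ ledger (p629489:
`c₁ ∣ c₀ ∣ 2c₁` at `4 ∣ N`; p3-g6 `velu_two_of_doubled_four_mul_prime`: at `N = 4p` DOUBLING `|c₀| = 2|c₁|` forces the globally minimal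
`W₁` to carry the `u = 1` Vélu `2`-pair `(720q² − 4c₄(W₀), 19008q³ − 144c₄(W₀)q)` of `W₀` at a rational `2`-torsion abscissa `q`)
COMPOSED with the two local inputs of this seat:
`padicValRat_velu_two_Δ` (p646201: `ord₂ Δ(W₁) + 3·ord₂ B = 2·ord₂ Δ_min(W₀)`, `B = 3q² − c₄(W₀)/48`) and
`padicValRat_veluB_eq_zero_of_IVstar` (`ord₂ B = 0` on a tame `IV*` curve).  So doubling would give `ord₂ Δ_min(W₁) = 16`, while
`W₁` is tame at `2` (`N(W₁) = 4p` by the Modularity Theorem `exists_isNewformOf` — the crux's fourth hypothesis — and strong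
multiplicity one, `IsNewformOf.level_eq_conductorNorm_of_exists_isNewformOf`) hence `ord₂ Δ_min(W₁) ∈ {4, 8}`
(`kodairaSymbolAt_of_four_dvd_conductorNorm`):

* `natAbs_maninConstant₀_ne_two_mul_of_IVstar_four_mul_prime` — no doubling; also the modularity-free form
  `…_of_tame` with `4 ∥ N(W₀)`, `4 ∥ N(W₁)` as hypotheses;
* `natAbs_maninConstant₀_eq_of_IVstar_four_mul_prime` — `|c₀| = |c₁|`;
* `dvd_maninConstant₀_iff_of_IVstar_four_mul_prime`, `not_two_dvd_maninConstant₀_iff_of_IVstar_four_mul_prime` — `ℓ ∣ c₀ ⟺ ℓ ∣ c₁`;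
  C2 for `D₀` ⟺ `2 ∤ c₁` on this stratum (MEMO-an E-an-66's transfer, now unconditional on `IV*` with NO blindness hypothesis —
  p3-g6's `natAbs_maninConstant₀_eq_of_allBlind_of_four_mul_prime` needed `AllRationalTwoTorsionBlind` on a `[0,a₂,0,a₄,a₆]` model).

HONEST FRAMING: no Manin constant is shown odd; C2, Manin's conjecture and BSD are not proved.  No definitions, no named facts, no
sorry.  References: [CesnaviciusNeururerSaha2023] Lemma 6.5; [LingOesterle1991] Thm. 6; [Stevens1989] (5.2)–(5.4);
[SilvermanATAEC1994] IV.9.4 Table 4.1; [DiamondShurman2005] Thm. 8.8.3; HOME/MEMO-an.md §66–§67 (E-an-66, E-an-120).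
-/

set_option autoImplicit false
set_option linter.dupNamespace false

noncomputable section

open scoped Classical
open WeierstrassCurve Literature.NumberTheory.EllipticCurves Literature.NumberTheory.EllipticCurves.ModularForms
open CongruenceSubgroup Polynomial

namespace Summit.BirchSwinnertonDyer.BirchSwinnertonDyer.Theorems.ManinLocalTwoThree

variable {W₁ W₀ : WeierstrassCurve ℚ} [W₁.IsElliptic] [W₁.IsGloballyMinimal] [W₀.IsElliptic]
  [W₀.IsGloballyMinimal]

/-- `ord₂ Δ_min ∈ {4, 8}` for a globally minimal curve with `4 ∥ N` (the tame dichotomy `IV`/`IV*` at `2`).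
[cite: SilvermanATAEC1994, IV.9.4 Table 4.1] -/
theorem padicValInt_minimalDiscriminantInt_eq_four_or_eight_of_tame_two (W : WeierstrassCurve ℚ) [W.IsElliptic]
    [W.IsGloballyMinimal] (h4 : 2 ^ 2 ∣ W.conductorNorm ℤ) (h8 : ¬ 2 ^ 3 ∣ W.conductorNorm ℤ) :
    padicValInt 2 W.minimalDiscriminantInt = 4 ∨ padicValInt 2 W.minimalDiscriminantInt = 8 := by
  set v : IsDedekindDomain.HeightOneSpectrum ℤ := (Rat.HeightOneSpectrum.primesEquiv (R := ℤ)).symm ⟨2, Nat.prime_two⟩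
    with hvdef
  have hv : Rat.HeightOneSpectrum.natGenerator v = 2 :=
    Literature.NumberTheory.EllipticCurves.Rat.natGenerator_primesEquiv_symm ⟨2, Nat.prime_two⟩
  rcases W.kodairaSymbolAt_of_four_dvd_conductorNorm v hv h4 h8 with ⟨-, h⟩ | ⟨-, h⟩
  · exact Or.inl h
  · exact Or.inr h

/-- **NO DOUBLING ON THE TAME `IV*` STRATUM, modularity-free form.**  `p` an odd prime, `(D₁, D₀)` the optimal `X₁(4p)`/`X₀(4p)` pair of a
class (`W₁`, `W₀` globally minimal, both TAME at `2`: `4 ∥ N(W₁)`, `4 ∥ N(W₀)`), `ord₂ Δ_min(W₀) = 8` (Kodaira `IV*`): `|c₀| ≠ 2|c₁|`.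
[cite: CesnaviciusNeururerSaha2023, Lemma 6.5] [cite: SilvermanATAEC1994, IV.9.4 Table 4.1] -/
theorem natAbs_maninConstant₀_ne_two_mul_of_IVstar_four_mul_prime_of_tame {p : ℕ} (hp : p.Prime) (hp2 : p ≠ 2)
    [NeZero (4 * p)] (D₁ : Gamma1ParametrizationData W₁ (4 * p)) (D₀ : ModularParametrizationData W₀ (4 * p))
    (hiso : IsIsogenous W₁ W₀) (h₁ : D₁.IsOptimal)
    (h₀ : ∀ z ∈ D₀.L.lattice, ∃ w ∈ periodLattice D₀.f, z = D₀.c * w)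
    (h4₀ : 2 ^ 2 ∣ W₀.conductorNorm ℤ) (h8₀ : ¬ 2 ^ 3 ∣ W₀.conductorNorm ℤ)
    (h4₁ : 2 ^ 2 ∣ W₁.conductorNorm ℤ) (h8₁ : ¬ 2 ^ 3 ∣ W₁.conductorNorm ℤ)
    (hΔ8 : padicValInt 2 W₀.minimalDiscriminantInt = 8) :
    D₀.maninConstant.natAbs ≠ 2 * D₁.maninConstant.natAbs := by
  intro hdbl
  obtain ⟨q, hq, hc4, hc6⟩ := velu_two_of_doubled_four_mul_prime hp hp2 D₁ D₀ hiso h₁ h₀ hdbl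
  haveI : Fact (Nat.Prime 2) := ⟨Nat.prime_two⟩
  have hB := padicValRat_veluB_eq_zero_of_IVstar W₀ h4₀ h8₀ hΔ8 q hq
  have hval := padicValRat_velu_two_Δ 2 W₀ q hq W₁ hc4 hc6
  rw [hB, ← cast_minimalDiscriminantInt W₁, ← cast_minimalDiscriminantInt W₀, padicValRat.of_int, padicValRat.of_int,
    hΔ8] at hval
  push_cast at hval
  rcases padicValInt_minimalDiscriminantInt_eq_four_or_eight_of_tame_two W₁ h4₁ h8₁ with h | h <;> rw [h] at hval <;>
    norm_num at hval

omit [W₁.IsGloballyMinimal] [W₀.IsGloballyMinimal] in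
/-- `4 ∥ N` at level `4p` (`p` an odd prime), granted `exists_isNewformOf`, for BOTH optimal data of a class. [cite: DiamondShurman2005, Thm. 8.8.3] -/
theorem four_dvd_not_eight_dvd_conductorNorm_of_level_four_mul_prime (hnf : exists_isNewformOf) {p : ℕ} (hp : p.Prime)
    (hp2 : p ≠ 2) [NeZero (4 * p)] (D₁ : Gamma1ParametrizationData W₁ (4 * p)) (D₀ : ModularParametrizationData W₀ (4 * p)) :
    (2 ^ 2 ∣ W₀.conductorNorm ℤ ∧ ¬ 2 ^ 3 ∣ W₀.conductorNorm ℤ) ∧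
      (2 ^ 2 ∣ W₁.conductorNorm ℤ ∧ ¬ 2 ^ 3 ∣ W₁.conductorNorm ℤ) := by
  have hodd : ¬ 2 ∣ p := fun h ↦ hp2 ((Nat.prime_dvd_prime_iff_eq Nat.prime_two hp).mp h).symm
  have key : 2 ^ 2 ∣ 4 * p ∧ ¬ 2 ^ 3 ∣ 4 * p := by
    refine ⟨⟨p, by ring⟩, fun h ↦ hodd ?_⟩
    have : 8 ∣ 4 * p := by simpa using h
    omega
  have hN₀ : 4 * p = W₀.conductorNorm ℤ := IsNewformOf.level_eq_conductorNorm_of_exists_isNewformOf hnf D₀.isNewformOf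
  have hN₁ : 4 * p = W₁.conductorNorm ℤ := IsNewformOf.level_eq_conductorNorm_of_exists_isNewformOf hnf D₁.isNewformOf
  exact ⟨hN₀ ▸ key, hN₁ ▸ key⟩

/-- **NO DOUBLING ON THE TAME `IV*` STRATUM AT `N = 4p`** (granted the Modularity Theorem `exists_isNewformOf`, the crux's own
hypothesis, for the conductors): `ord₂ Δ_min(W₀) = 8` ⟹ `|c₀| ≠ 2|c₁|`. [cite: CesnaviciusNeururerSaha2023, Lemma 6.5] [cite: DiamondShurman2005, Thm. 8.8.3] -/
theorem natAbs_maninConstant₀_ne_two_mul_of_IVstar_four_mul_prime (hnf : exists_isNewformOf) {p : ℕ} (hp : p.Prime)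
    (hp2 : p ≠ 2) [NeZero (4 * p)] (D₁ : Gamma1ParametrizationData W₁ (4 * p)) (D₀ : ModularParametrizationData W₀ (4 * p))
    (hiso : IsIsogenous W₁ W₀) (h₁ : D₁.IsOptimal)
    (h₀ : ∀ z ∈ D₀.L.lattice, ∃ w ∈ periodLattice D₀.f, z = D₀.c * w)
    (hΔ8 : padicValInt 2 W₀.minimalDiscriminantInt = 8) :
    D₀.maninConstant.natAbs ≠ 2 * D₁.maninConstant.natAbs := by
  obtain ⟨⟨h4₀, h8₀⟩, ⟨h4₁, h8₁⟩⟩ := four_dvd_not_eight_dvd_conductorNorm_of_level_four_mul_prime hnf hp hp2 D₁ D₀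
  exact natAbs_maninConstant₀_ne_two_mul_of_IVstar_four_mul_prime_of_tame hp hp2 D₁ D₀ hiso h₁ h₀ h4₀ h8₀ h4₁ h8₁ hΔ8

/-- **`|c₀| = |c₁|` on the tame `IV*` stratum at `N = 4p`** (ledger dichotomy `|c₀| ∈ {|c₁|, 2|c₁|}` at `4 ∣ N`, minus doubling).
[cite: CesnaviciusNeururerSaha2023, Lemma 6.5] [cite: LingOesterle1991, Thm. 6] -/
theorem natAbs_maninConstant₀_eq_of_IVstar_four_mul_prime (hnf : exists_isNewformOf) {p : ℕ} (hp : p.Prime) (hp2 : p ≠ 2)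
    [NeZero (4 * p)] (D₁ : Gamma1ParametrizationData W₁ (4 * p)) (D₀ : ModularParametrizationData W₀ (4 * p))
    (hiso : IsIsogenous W₁ W₀) (h₁ : D₁.IsOptimal)
    (h₀ : ∀ z ∈ D₀.L.lattice, ∃ w ∈ periodLattice D₀.f, z = D₀.c * w)
    (hΔ8 : padicValInt 2 W₀.minimalDiscriminantInt = 8) :
    D₀.maninConstant.natAbs = D₁.maninConstant.natAbs :=
  (natAbs_maninConstant₀_eq_or_eq_two_mul_of_four_dvd_level D₁ D₀ hiso h₁ h₀ ⟨p, rfl⟩).resolve_right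
    (natAbs_maninConstant₀_ne_two_mul_of_IVstar_four_mul_prime hnf hp hp2 D₁ D₀ hiso h₁ h₀ hΔ8)

/-- **`ℓ ∣ c₀ ⟺ ℓ ∣ c₁` on the tame `IV*` stratum at `N = 4p`**, every integer `ℓ`. [cite: CesnaviciusNeururerSaha2023, Lemma 6.5] -/
theorem dvd_maninConstant₀_iff_of_IVstar_four_mul_prime (hnf : exists_isNewformOf) {p : ℕ} (hp : p.Prime) (hp2 : p ≠ 2)
    [NeZero (4 * p)] (D₁ : Gamma1ParametrizationData W₁ (4 * p)) (D₀ : ModularParametrizationData W₀ (4 * p))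
    (hiso : IsIsogenous W₁ W₀) (h₁ : D₁.IsOptimal)
    (h₀ : ∀ z ∈ D₀.L.lattice, ∃ w ∈ periodLattice D₀.f, z = D₀.c * w)
    (hΔ8 : padicValInt 2 W₀.minimalDiscriminantInt = 8) (ℓ : ℤ) :
    ℓ ∣ D₀.maninConstant ↔ ℓ ∣ D₁.maninConstant := by
  have heq := natAbs_maninConstant₀_eq_of_IVstar_four_mul_prime hnf hp hp2 D₁ D₀ hiso h₁ h₀ hΔ8
  rw [← Int.natAbs_dvd_natAbs, ← Int.natAbs_dvd_natAbs (b := D₁.maninConstant), heq]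

/-- **C2 on the optimal curve ⟺ Stevens' parity `2 ∤ c₁`, on the tame `IV*` stratum at `N = 4p`.**
[cite: CesnaviciusNeururerSaha2023, Lemma 6.5] [cite: Stevens1989, (5.2)–(5.4)] -/
theorem not_two_dvd_maninConstant₀_iff_of_IVstar_four_mul_prime (hnf : exists_isNewformOf) {p : ℕ} (hp : p.Prime)
    (hp2 : p ≠ 2) [NeZero (4 * p)] (D₁ : Gamma1ParametrizationData W₁ (4 * p)) (D₀ : ModularParametrizationData W₀ (4 * p))
    (hiso : IsIsogenous W₁ W₀) (h₁ : D₁.IsOptimal)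
    (h₀ : ∀ z ∈ D₀.L.lattice, ∃ w ∈ periodLattice D₀.f, z = D₀.c * w)
    (hΔ8 : padicValInt 2 W₀.minimalDiscriminantInt = 8) :
    ¬ (2 : ℤ) ∣ D₀.maninConstant ↔ ¬ (2 : ℤ) ∣ D₁.maninConstant :=
  (dvd_maninConstant₀_iff_of_IVstar_four_mul_prime hnf hp hp2 D₁ D₀ hiso h₁ h₀ hΔ8 2).not

end Summit.BirchSwinnertonDyer.BirchSwinnertonDyer.Theorems.ManinLocalTwoThree

end
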